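import Summits.QuantumFields.YangMills.Theorems.BalabanUVNodesPortS1G3CTwinRestrict

/-!
# NODE O port PT-A, offer (ζ) for `stub_G3C` of 27930 — ★★★ THE OFF-WRAP BRIDGE OF ROW (gZ): `(g3cWZ F Mc TZY x).piece X φ = g3cW … X φ = g3cEG … X φ` for every `X ∉ recordWrapCtr`, and the
# packaged row `g3cEGZ_row` ((Z-loc), (Z-cov), bridge) from the P0-ℂ carrier clauses

Cell `ym-nodeO-ideate`, porter seat `ymgap-nodeO-port-PTA-1` (gen 8), on ★★★ director-ym №573 (2); `--supports stmt-QuantumFields-27930` (helper, P0-free).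
[I] = [Balaban1987RG1], [B9] = [Balaban1985BackgroundPropagators], [16] = [Balaban1985UV3].

* §1 ★ `g3cLocInvZ_eq_reindex` — the integer local inverse on `X̂_K(Z)` is the reindexed restriction of the torus local inverse `G_Z` (`Z ⊆ X`): the restricted blocks correspond under the induced
  index equivalence `{i ∕∕ InDom Z i} ≃ {î ∕∕ twinCube î ∈ X̂_K(Z)}` (✓`sum_subdom_eq_sum_powerset_intCubes` for `T^{(Z)}`), and `Matrix.inv_reindex`.
* §2 ★ `g3cStepMZ_lift`, ★ `g3cWalkTermZ_lift` — every admissible step matrix and every walk term reads the same on the integer index (restriction is multiplicative on the `X`-supported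
  factors, reindexing is a ring map, the trace is kept).
* §3 ★ `g3cWmZ_piece` — the walk sums correspond: start cubes `q₀ ∈ X ↔ ι q₀ ∈ X̂`, steps `(□, Y) ↦ (ι □, X̂_K(Y))` (injective), localization ✓`g3cWalkLocZ_lift_iff`, and the integer steps that are
  not lifts carry a vanishing `TZ_Ŷ` ((Z-dom), ✓`twinMat_eq_zero_of_not_lift`).
* §4 ★★★ `g3cWZ_piece_eq_g3cW`, `g3cWZ_piece_eq_g3cEG` (the collector's seat `X_full` is in the wrap class, ✓`g3cFull_mem_recordWrapCtr`), and `g3cEGZ_row` — row (gZ) of `G3CPiecesAt` for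
  `EG x n X φ := g3cEG F Mc k (K₀+n) (TC n) (TY n) x X φ`, `EGZ x := g3cWZ F Mc TZY x`, from `P0CarrierClauses` + `McGuard`.

HONEST FRAMING.  Bookkeeping over DISPLAYED clauses of the P0-ℂ body (inhabited nowhere): this closes the (gZ) integer-twin row of the hand's `G3CPiecesAt` for its walk pieces, NOT `stub_G3C`
(whose inhabitant still needs (α) `O_X` + degraded clauses, (β) the walk-sum bounds, (γ) the M-test ∕ continuity assembly, (δ) the closer); NOTHING of Bałaban's estimates asserted, ported or
discharged; 27930 OPEN · no claim; NODE O 0∕1; COUNT 8∕28 · K 1∕4 UNMOVED; finite `𝕋⁴_{L^K}` at fixed ε — NOT continuum ∕ OS ∕ Clay; **the Yang–Mills mass gap is NOT proved by any of this.**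
No `sorry`, no `instance`, no `notation`; standard axioms.
-/

noncomputable section

open scoped BigOperators
open Finset

namespace Summit.QuantumFields.YangMills.Theorems.BalabanUVNodesPortS1

open Summit.QuantumFields.YangMills.Theorems.K0RecordFormatNames
open Literature.MathematicalPhysics.QuantumFieldTheory.Balaban1983to89
open Literature.MathematicalPhysics.QuantumFieldTheory.Balaban1983to89.Node00
open Literature.MathematicalPhysics.QuantumFieldTheory.Balaban1983to89.T4Continuum (T4Family)
open Literature.MathematicalPhysics.QuantumFieldTheory.Balaban1983to89.TreeLengthTorus (TPt IsTDom proj)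
open Literature.MathematicalPhysics.QuantumLattice (blockMap blockSites mem_blockSites_iff)

section Record

variable {F : T4Family}
variable {Mc k K : ℕ} (hMc : McGuard F Mc) (hK : recordK₀ F Mc k ≤ K) {X : (recordDomSys F Mc k K).Dom} (hX : X ∉ recordWrapCtr F Mc k K)
variable (TYK : (recordDomSys F Mc k K).Dom → Sect2.CPair (F.P K) (MatA 2) → FluctIdx F k K → FluctIdx F k K → ℂ)
  (TZY : Finset (Fin 4 → ℤ) → IntBondCfg → ((Fin 4 → ℤ) × Fin 4) × Fin 3 → ((Fin 4 → ℤ) × Fin 4) × Fin 3 → ℂ) (φ : Sect2.CPair (F.P K) (MatA 2)) (x : ℝ)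
variable
  (hZsupp : ∀ (Xh : Finset (Fin 4 → ℤ)) (f : IntBondCfg) (bi bj : (Fin 4 → ℤ) × Fin 4) (a a' : Fin 3),
    (blockMap (F.L * Mc) bi.1 ∉ Xh ∨ blockMap (F.L * Mc) bj.1 ∉ Xh) → TZY Xh f (bi, a) (bj, a') = 0)
  (hZdom : ∀ (Xh : Finset (Fin 4 → ℤ)) (f : IntBondCfg) (i j : ((Fin 4 → ℤ) × Fin 4) × Fin 3), ¬ (Xh.Nonempty ∧ B13ScaleTransfer.FaceConnected Xh) → TZY Xh f i j = 0)
  (hZbr : ∀ (Y : (recordDomSys F Mc k K).Dom), Y ∉ recordWrapCtr F Mc k K →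
    ∀ (ψ : Sect2.CPair (F.P K) (MatA 2)) (bi bj : (Fin 4 → ℤ) × Fin 4) (a a' : Fin 3),
      blockMap (F.L * Mc) bi.1 ∈ intCubes F Mc k K Y → blockMap (F.L * Mc) bj.1 ∈ intCubes F Mc k K Y →
        TYK Y ψ (coverBondAt (F.P K) k bi, a) (coverBondAt (F.P K) k bj, a') = TZY (intCubes F Mc k K Y) (pullPair F K ψ) (bi, a) (bj, a'))
  (hsupp : ∀ Y ψ (s s' : NonB0Idx F k K),
    (cubeOfSite F Mc k K (blockOf s.1.1.src) ∉ (Y.1 : Finset (TPt (F.P K).d (Sect2.domCount (F.P K) Mc (k + 1)))) ∨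
      cubeOfSite F Mc k K (blockOf s'.1.1.src) ∉ (Y.1 : Finset (TPt (F.P K).d (Sect2.domCount (F.P K) Mc (k + 1))))) → TYK Y ψ s.1 s'.1 = 0)

/-! ## §1  The local inverse on the integer index -/

include hZsupp hZdom hZbr hsupp in
/-- **Entries of `T^{(X̂_K(Z))}(φ ∘ π)` on the integer index are those of `T^{(Z)}(φ)` along `e⁻¹`** (`Z ⊆ X`; the non-lift subsets of `X̂_K(Z)` contribute nothing by (Z-dom)).
[cite: Balaban1987RG1, (1.7) p.261, (1.21) p.264] -/
theorem g3cLocOpZ_apply_eq {Z : (recordDomSys F Mc k K).Dom} (hZX : (Z.1 : Finset (TPt (F.P K).d (Sect2.domCount (F.P K) Mc (k + 1)))) ⊆ X.1)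
    (i j : TwinIdx F Mc (intCubes F Mc k K X)) :
    g3cLocOpZ F Mc TZY (intCubes F Mc k K X) (intCubes F Mc k K Z) (pullPair F K φ) i j =
      g3cLocOp F Mc k K TYK Z φ ((twinIdxEquiv hMc hK X hX).symm i).1 ((twinIdxEquiv hMc hK X hX).symm j).1 := by
  classical
  unfold g3cLocOpZ g3cLocOp
  rw [Matrix.sum_apply, Matrix.of_apply]
  symm
  have h := sum_subdom_eq_sum_powerset_intCubes Z (fun Yh => twinMat F Mc TZY (intCubes F Mc k K X) Yh (pullPair F K φ) i j) fun Yh hYh hnot => by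
    rw [twinMat_eq_zero_of_not_lift Z hZdom hYh hnot]; rfl
  refine Eq.trans (Finset.sum_congr rfl fun Y hY => ?_) h
  have hYX : (Y.1 : Finset (TPt (F.P K).d (Sect2.domCount (F.P K) Mc (k + 1)))) ⊆ X.1 := (Finset.mem_filter.1 hY).2.trans hZX
  rw [twinMat_intCubes_eq_reindex hMc hK hX TYK TZY φ hZsupp hZbr hsupp hYX]
  rfl

include hZsupp hZdom hZbr hsupp in
/-- ★ **THE INTEGER LOCAL INVERSE IS THE REINDEXED TORUS LOCAL INVERSE**: `Ĝ_{X̂_K(Z)}(x, φ ∘ π) = e ∘ G_Z(x, φ)|_X ∘ e⁻¹` for `Z ⊆ X` off the wrap class (the restricted blocks agree along the induced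
equivalence of their index subtypes; `Matrix.inv_reindex`). [cite: Balaban1985BackgroundPropagators, (3.87)–(3.88) p.409; Balaban1985UV3, p.272; Balaban1987RG1, (1.21) p.264] -/
theorem g3cLocInvZ_eq_reindex {Z : (recordDomSys F Mc k K).Dom} (hZX : (Z.1 : Finset (TPt (F.P K).d (Sect2.domCount (F.P K) Mc (k + 1)))) ⊆ X.1) :
    g3cLocInvZ F Mc TZY (intCubes F Mc k K X) (intCubes F Mc k K Z) x (pullPair F K φ) =
      Matrix.reindex (twinIdxEquiv hMc hK X hX) (twinIdxEquiv hMc hK X hX) ((g3cLocInv F Mc k K TYK Z x φ).submatrix Subtype.val Subtype.val) := by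
  classical
  -- the induced equivalence of the index subtypes of the two restricted blocks
  let eZ : {i : NonB0Idx F k K // g3cInDom F Mc k K Z i} ≃ {i : TwinIdx F Mc (intCubes F Mc k K X) // twinCube F Mc i ∈ intCubes F Mc k K Z} :=
    { toFun := fun i => ⟨twinIdxEquiv hMc hK X hX ⟨i.1, hZX (cubeOfSite_blockOf_mem_of_embIter_mem_domSites hMc hK Z _ i.2)⟩, by
        rw [twinCube_twinIdxEquiv]
        exact Finset.mem_image_of_mem _ (cubeOfSite_blockOf_mem_of_embIter_mem_domSites hMc hK Z _ i.2)⟩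
      invFun := fun i => ⟨((twinIdxEquiv hMc hK X hX).symm i.1).1, (g3cInDom_symm_iff hMc hK hX Z i.1).2 i.2⟩
      left_inv := fun i => Subtype.ext (by simp only [Equiv.symm_apply_apply])
      right_inv := fun i => Subtype.ext (by
        simp only
        exact (congrArg (twinIdxEquiv hMc hK X hX) (Subtype.ext rfl)).trans ((twinIdxEquiv hMc hK X hX).apply_symm_apply i.1)) }
  -- the restricted blocks correspond
  have hB : g3cLocBlockZ F Mc TZY (intCubes F Mc k K X) (intCubes F Mc k K Z) x (pullPair F K φ) = Matrix.reindex eZ eZ (g3cLocBlock F Mc k K TYK Z x φ) := by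
    ext a b
    rw [Matrix.reindex_apply, Matrix.submatrix_apply]
    unfold g3cLocBlockZ g3cLocBlock
    rw [Matrix.add_apply, Matrix.add_apply, Matrix.smul_apply, Matrix.smul_apply, Matrix.one_apply, Matrix.one_apply,
      Matrix.submatrix_apply, Matrix.submatrix_apply]
    simp only [eZ.symm.injective.eq_iff]
    congr 1
    exact g3cLocOpZ_apply_eq hMc hK hX TYK TZY φ hZsupp hZdom hZbr hsupp hZX a.1 b.1
  have hinv : (g3cLocBlockZ F Mc TZY (intCubes F Mc k K X) (intCubes F Mc k K Z) x (pullPair F K φ))⁻¹ = Matrix.reindex eZ eZ (g3cLocBlock F Mc k K TYK Z x φ)⁻¹ := by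
    rw [hB, Matrix.inv_reindex]
  ext i j
  rw [Matrix.reindex_apply, Matrix.submatrix_apply, Matrix.submatrix_apply]
  by_cases hi : twinCube F Mc i ∈ intCubes F Mc k K Z
  · by_cases hj : twinCube F Mc j ∈ intCubes F Mc k K Z
    · rw [g3cLocInvZ_apply_of_mem F Mc TZY _ _ x _ hi hj,
        g3cLocInv_apply_of_mem Mc k K TYK Z x φ ((g3cInDom_symm_iff hMc hK hX Z i).2 hi) ((g3cInDom_symm_iff hMc hK hX Z j).2 hj), hinv,
        Matrix.reindex_apply, Matrix.submatrix_apply]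
      rfl
    · rw [g3cLocInvZ_apply_of_not_mem F Mc TZY _ _ x _ (Or.inr hj), g3cLocInv_apply_of_not_mem Mc k K TYK Z x φ (Or.inr (mt (g3cInDom_symm_iff hMc hK hX Z j).1 hj))]
  · rw [g3cLocInvZ_apply_of_not_mem F Mc TZY _ _ x _ (Or.inl hi), g3cLocInv_apply_of_not_mem Mc k K TYK Z x φ (Or.inl (mt (g3cInDom_symm_iff hMc hK hX Z i).1 hi))]

/-! ## §2  Step matrices and walk terms -/

/-- The columns of an admissible torus step matrix vanish off the indices of `X` (its last factor is `𝟙_□`, `□ ∈ X`). [cite: Balaban1985BackgroundPropagators, (3.88) p.409] -/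
theorem g3cStepM_col_zero {s : TPt (F.P K).d (Sect2.domCount (F.P K) Mc (k + 1)) × (recordDomSys F Mc k K).Dom}
    (hq : ((g3cBlk F Mc k K s.1).1 : Finset (TPt (F.P K).d (Sect2.domCount (F.P K) Mc (k + 1)))) ⊆ X.1) :
    ∀ a l : NonB0Idx F k K, ¬ cubeOfSite F Mc k K (blockOf l.1.1.src) ∈ (X.1 : Finset (TPt (F.P K).d (Sect2.domCount (F.P K) Mc (k + 1)))) →
      g3cStepM F Mc k K TYK x φ s a l = 0 := by
  intro a l hl
  unfold g3cStepM
  split_ifs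
  · rfl
  · unfold g3cStep
    exact col_zero_mul (fun t : NonB0Idx F k K => cubeOfSite F Mc k K (blockOf t.1.1.src) ∈ (X.1 : Finset _)) _ _
      (fun t l hl => g3cInd_zero_off (X := X) (hq (mem_g3cBlk_self Mc k K s.1)) t l (Or.inr hl)) a l hl

include hZsupp hZdom hZbr hsupp in
/-- ★ **EVERY ADMISSIBLE STEP MATRIX READS THE SAME ON THE INTEGER INDEX**: `Ŝ^M_{(ι□, X̂_K(Y))}(x, φ ∘ π) = e ∘ S^M_{(□,Y)}(x, φ)|_X ∘ e⁻¹` for `□̃ ⊆ X`, `Y ⊆ X` off the wrap class.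
[cite: Balaban1985BackgroundPropagators, (3.88) p.409; Balaban1987RG1, (1.21) p.264] -/
theorem g3cStepMZ_lift {q : TPt (F.P K).d (Sect2.domCount (F.P K) Mc (k + 1))} {Y : (recordDomSys F Mc k K).Dom}
    (hq : ((g3cBlk F Mc k K q).1 : Finset (TPt (F.P K).d (Sect2.domCount (F.P K) Mc (k + 1)))) ⊆ X.1)
    (hYX : (Y.1 : Finset (TPt (F.P K).d (Sect2.domCount (F.P K) Mc (k + 1)))) ⊆ X.1) :
    g3cStepMZ F Mc TZY (intCubes F Mc k K X) x (pullPair F K φ) (g3cLiftStep F Mc k K (q, Y)) =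
      Matrix.reindex (twinIdxEquiv hMc hK X hX) (twinIdxEquiv hMc hK X hX) ((g3cStepM F Mc k K TYK x φ (q, Y)).submatrix Subtype.val Subtype.val) := by
  classical
  have hiff : intCubes F Mc k K Y ⊆ g3cBlkZ (fun i => ((q i).valMinAbs : ℤ)) ↔
      (Y.1 : Finset (TPt (F.P K).d (Sect2.domCount (F.P K) Mc (k + 1)))) ⊆ (g3cBlk F Mc k K q).1 := by
    rw [← intCubes_g3cBlk hX hq]
    exact ⟨subset_of_intCubes_subset, fun h => Finset.image_subset_image h⟩
  show (if intCubes F Mc k K Y ⊆ g3cBlkZ (fun i => ((q i).valMinAbs : ℤ)) then (0 : Matrix _ _ ℂ)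
      else g3cStepZ F Mc TZY (intCubes F Mc k K X) (fun i => ((q i).valMinAbs : ℤ)) (intCubes F Mc k K Y) x (pullPair F K φ)) =
    Matrix.reindex (twinIdxEquiv hMc hK X hX) (twinIdxEquiv hMc hK X hX)
      ((if (Y.1 : Finset (TPt (F.P K).d (Sect2.domCount (F.P K) Mc (k + 1)))) ⊆ (g3cBlk F Mc k K q).1 then (0 : Matrix _ _ ℂ)
        else g3cStep F Mc k K TYK q Y x φ).submatrix Subtype.val Subtype.val)
  split_ifs with h1 h2 h2
  · ext i j; rfl
  · exact absurd (hiff.1 h1) h2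
  · exact absurd (hiff.2 h2) h1
  · -- the product `T_Y · P_□̃ · G_□̃ · 𝟙_□`, factor by factor
    have hP : ∀ a l : NonB0Idx F k K, ¬ cubeOfSite F Mc k K (blockOf l.1.1.src) ∈ (X.1 : Finset (TPt (F.P K).d (Sect2.domCount (F.P K) Mc (k + 1)))) →
        g3cProj F Mc k K (g3cBlk F Mc k K q) a l = 0 := fun a l hl => g3cProj_zero_off hMc hK hq a l (Or.inr hl)
    have hT : ∀ a l : NonB0Idx F k K, ¬ cubeOfSite F Mc k K (blockOf l.1.1.src) ∈ (X.1 : Finset (TPt (F.P K).d (Sect2.domCount (F.P K) Mc (k + 1)))) →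
        nonB0Block F k K (TYK Y φ) a l = 0 := fun a l hl => nonB0Block_zero_off TYK φ hsupp hYX a l (Or.inr hl)
    have hG : ∀ a l : NonB0Idx F k K, ¬ cubeOfSite F Mc k K (blockOf l.1.1.src) ∈ (X.1 : Finset (TPt (F.P K).d (Sect2.domCount (F.P K) Mc (k + 1)))) →
        g3cLocInv F Mc k K TYK (g3cBlk F Mc k K q) x φ a l = 0 := fun a l hl => g3cLocInv_zero_off hMc hK TYK φ x hq a l (Or.inr hl)
    unfold g3cStep g3cStepZ
    rw [submatrix_mul_of_col_zero _ _ _ (col_zero_mul _ _ _ hG), submatrix_mul_of_col_zero _ _ _ (col_zero_mul _ _ _ hP), submatrix_mul_of_col_zero _ _ _ hT,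
      ← reindex_mul_reindex, ← reindex_mul_reindex, ← reindex_mul_reindex,
      ← twinMat_intCubes_eq_reindex hMc hK hX TYK TZY φ hZsupp hZbr hsupp hYX, ← g3cIndZ_eq_reindex hMc hK hX q,
      ← g3cLocInvZ_eq_reindex hMc hK hX TYK TZY φ x hZsupp hZdom hZbr hsupp hq, ← g3cProjZ_eq_reindex hMc hK hX, intCubes_g3cBlk hX hq]

include hMc hK hX hZsupp hZdom hZbr hsupp in
/-- ★ **EVERY WALK TERM READS THE SAME ON THE INTEGER INDEX**: `t̂(ι□₀, ŵ)(x, φ ∘ π) = t(□₀, w)(x, φ)` when all blocks `□̃_i` and all `Y_i` lie in the off-wrap `X` (restriction is multiplicative on the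
`X`-supported factors, `Matrix.reindex` is a ring map, and the trace is kept). [cite: Balaban1985BackgroundPropagators, (3.90) p.409; Balaban1985UV3, (25) p.262; Balaban1987RG1, (1.21) p.264] -/
theorem g3cWalkTermZ_lift {q₀ : TPt (F.P K).d (Sect2.domCount (F.P K) Mc (k + 1))} {m : ℕ}
    {w : Fin m → TPt (F.P K).d (Sect2.domCount (F.P K) Mc (k + 1)) × (recordDomSys F Mc k K).Dom}
    (h0 : ((g3cBlk F Mc k K q₀).1 : Finset (TPt (F.P K).d (Sect2.domCount (F.P K) Mc (k + 1)))) ⊆ X.1)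
    (hs : ∀ i, ((w i).2.1 : Finset (TPt (F.P K).d (Sect2.domCount (F.P K) Mc (k + 1)))) ⊆ X.1 ∧ ((g3cBlk F Mc k K (w i).1).1 : Finset _) ⊆ X.1) :
    g3cWalkTermZ F Mc TZY (intCubes F Mc k K X) x (pullPair F K φ) (fun i => ((q₀ i).valMinAbs : ℤ)) (fun i => g3cLiftStep F Mc k K (w i)) =
      g3cWalkTerm F Mc k K TYK x φ q₀ w := by
  classical
  have hG : ∀ a l : NonB0Idx F k K, ¬ cubeOfSite F Mc k K (blockOf l.1.1.src) ∈ (X.1 : Finset (TPt (F.P K).d (Sect2.domCount (F.P K) Mc (k + 1)))) →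
      g3cLocInv F Mc k K TYK (g3cBlk F Mc k K q₀) x φ a l = 0 := fun a l hl => g3cLocInv_zero_off hMc hK TYK φ x h0 a l (Or.inr hl)
  have hGrow : ∀ a l : NonB0Idx F k K, ¬ cubeOfSite F Mc k K (blockOf a.1.1.src) ∈ (X.1 : Finset (TPt (F.P K).d (Sect2.domCount (F.P K) Mc (k + 1)))) →
      g3cLocInv F Mc k K TYK (g3cBlk F Mc k K q₀) x φ a l = 0 := fun a l ha => g3cLocInv_zero_off hMc hK TYK φ x h0 a l (Or.inl ha)
  have hI : ∀ a l : NonB0Idx F k K, ¬ cubeOfSite F Mc k K (blockOf l.1.1.src) ∈ (X.1 : Finset (TPt (F.P K).d (Sect2.domCount (F.P K) Mc (k + 1)))) →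
      g3cInd F Mc k K q₀ a l = 0 := fun a l hl => g3cInd_zero_off (X := X) (h0 (mem_g3cBlk_self Mc k K q₀)) a l (Or.inr hl)
  have hS : ∀ A ∈ List.ofFn (fun i => g3cStepM F Mc k K TYK x φ (w i)), ∀ a l : NonB0Idx F k K,
      ¬ cubeOfSite F Mc k K (blockOf l.1.1.src) ∈ (X.1 : Finset (TPt (F.P K).d (Sect2.domCount (F.P K) Mc (k + 1)))) → A a l = 0 := by
    intro A hA
    obtain ⟨i, rfl⟩ := List.mem_ofFn.1 hA
    exact g3cStepM_col_zero TYK φ x (hs i).2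
  -- the list of integer steps is the list of reindexed restrictions
  have hL : (List.ofFn fun i => g3cStepMZ F Mc TZY (intCubes F Mc k K X) x (pullPair F K φ) (g3cLiftStep F Mc k K (w i))) =
      ((List.ofFn fun i => g3cStepM F Mc k K TYK x φ (w i)).map fun A => A.submatrix Subtype.val Subtype.val).map
        fun A => Matrix.reindex (twinIdxEquiv hMc hK X hX) (twinIdxEquiv hMc hK X hX) A := by
    simp only [List.map_ofFn]
    exact congrArg List.ofFn (funext fun i => g3cStepMZ_lift hMc hK hX TYK TZY φ x hZsupp hZdom hZbr hsupp (hs i).2 (hs i).1)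
  unfold g3cWalkTermZ g3cWalkTerm
  rw [hL, listProd_map_reindex, ← submatrix_listProd_of_col_zero _ _ hS, ← intCubes_g3cBlk hX h0,
    g3cLocInvZ_eq_reindex hMc hK hX TYK TZY φ x hZsupp hZdom hZbr hsupp h0, g3cIndZ_eq_reindex hMc hK hX q₀, reindex_mul_reindex, reindex_mul_reindex,
    ← submatrix_mul_of_col_zero _ _ _ hG, ← submatrix_mul_of_col_zero _ _ _ (col_zero_mul _ _ _ hI)]
  -- the trace is kept by the reindexing (✓`TubeZeroFreeChannel.trace_reindex_eq`, inlined) and by the restriction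
  have htr : ∀ N : Matrix {t : NonB0Idx F k K // cubeOfSite F Mc k K (blockOf t.1.1.src) ∈ (X.1 : Finset (TPt (F.P K).d (Sect2.domCount (F.P K) Mc (k + 1))))}
      {t : NonB0Idx F k K // cubeOfSite F Mc k K (blockOf t.1.1.src) ∈ (X.1 : Finset (TPt (F.P K).d (Sect2.domCount (F.P K) Mc (k + 1))))} ℂ,
      (Matrix.reindex (twinIdxEquiv hMc hK X hX) (twinIdxEquiv hMc hK X hX) N).trace = N.trace := fun N => by
    simp only [Matrix.trace, Matrix.diag, Matrix.reindex_apply, Matrix.submatrix_apply]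
    exact (twinIdxEquiv hMc hK X hX).symm.sum_comp fun i => N i i
  rw [htr]
  exact (trace_eq_trace_submatrix_of_diag_zero (fun t : NonB0Idx F k K => cubeOfSite F Mc k K (blockOf t.1.1.src) ∈ (X.1 : Finset (TPt (F.P K).d (Sect2.domCount (F.P K) Mc (k + 1)))))
    _ fun a ha => row_zero_mul _ _ _ (row_zero_mul _ _ _ hGrow) a a ha).symm

/-! ## §3  The walk sums -/

include hMc hK hX hZsupp hZdom hZbr hsupp in
/-- ★ **THE WALK SUMS CORRESPOND**: `Ŵ_m(X̂_K(X))(φ ∘ π) = W_m(X)(φ)` off the wrap class. [cite: Balaban1987RG1, (1.7) p.261, (1.21) p.264; Balaban1985BackgroundPropagators, (3.90) p.409] -/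
theorem g3cWmZ_piece (m : ℕ) :
    g3cWmZ F Mc TZY x m (intCubes F Mc k K X) (pullPair F K φ) = g3cWm F Mc k K TYK x φ m X := by
  classical
  -- torus side: only start cubes in `X` and steps in `X × {Y ⊆ X}` have localization `X`
  have hRHS : g3cWm F Mc k K TYK x φ m X =
      ∑ q₀ ∈ (X.1 : Finset (TPt (F.P K).d (Sect2.domCount (F.P K) Mc (k + 1)))),
        ∑ w ∈ Fintype.piFinset (fun _ : Fin m => (X.1 : Finset (TPt (F.P K).d (Sect2.domCount (F.P K) Mc (k + 1)))) ×ˢ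
            (Finset.univ : Finset (recordDomSys F Mc k K).Dom).filter (fun Y => (Y.1 : Finset (TPt (F.P K).d (Sect2.domCount (F.P K) Mc (k + 1)))) ⊆ X.1)),
          if g3cWalkLoc F Mc k K q₀ w = X.1 then g3cWalkTerm F Mc k K TYK x φ q₀ w else 0 := by
    unfold g3cWm
    rw [← Finset.sum_subset (Finset.subset_univ (X.1 : Finset (TPt (F.P K).d (Sect2.domCount (F.P K) Mc (k + 1)))))]
    · refine Finset.sum_congr rfl fun q₀ _ => ?_
      rw [← Finset.sum_subset (Finset.subset_univ _)]
      intro w _ hw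
      rw [if_neg]
      intro hloc
      obtain ⟨-, hs⟩ := subset_of_g3cWalkLoc_eq hloc
      exact hw (Fintype.mem_piFinset.2 fun i => Finset.mem_product.2
        ⟨(hs i).2 (mem_g3cBlk_self Mc k K (w i).1), Finset.mem_filter.2 ⟨Finset.mem_univ _, (hs i).1⟩⟩)
    · intro q₀ _ hq₀
      refine Finset.sum_eq_zero fun w _ => ?_
      rw [if_neg]
      intro hloc
      exact hq₀ ((subset_of_g3cWalkLoc_eq hloc).1 (mem_g3cBlk_self Mc k K q₀))
  rw [hRHS]
  unfold g3cWmZ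
  -- start cubes: `q̂₀ ∈ X̂_K(X) = ι(X)`, `ι` injective
  refine (Finset.sum_image fun a _ b _ h => valMinAbs_lift_injective _ h).trans (Finset.sum_congr rfl fun q₀ hq₀ => ?_)
  show (∑ wh ∈ Fintype.piFinset (fun _ : Fin m => intCubes F Mc k K X ×ˢ (intCubes F Mc k K X).powerset),
      if g3cWalkLocZ (fun i => ((q₀ i).valMinAbs : ℤ)) wh = intCubes F Mc k K X then
        g3cWalkTermZ F Mc TZY (intCubes F Mc k K X) x (pullPair F K φ) (fun i => ((q₀ i).valMinAbs : ℤ)) wh else 0) = _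
  -- steps: the lifted steps; the other integer steps carry a vanishing `TZ_Ŷ`
  have himg : (Fintype.piFinset (fun _ : Fin m => (X.1 : Finset (TPt (F.P K).d (Sect2.domCount (F.P K) Mc (k + 1)))) ×ˢ
        (Finset.univ : Finset (recordDomSys F Mc k K).Dom).filter (fun Y => (Y.1 : Finset (TPt (F.P K).d (Sect2.domCount (F.P K) Mc (k + 1)))) ⊆ X.1))).image
        (fun w i => g3cLiftStep F Mc k K (w i)) ⊆
      Fintype.piFinset (fun _ : Fin m => intCubes F Mc k K X ×ˢ (intCubes F Mc k K X).powerset) := by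
    intro wh hwh
    obtain ⟨w, hw, rfl⟩ := Finset.mem_image.1 hwh
    have hwW := Fintype.mem_piFinset.1 hw
    refine Fintype.mem_piFinset.2 fun i => Finset.mem_product.2 ⟨?_, ?_⟩
    · show (fun j => (((w i).1 j).valMinAbs : ℤ)) ∈ intCubes F Mc k K X
      exact Finset.mem_image_of_mem _ (Finset.mem_product.1 (hwW i)).1
    · show intCubes F Mc k K (w i).2 ∈ (intCubes F Mc k K X).powerset
      exact Finset.mem_powerset.2 (Finset.image_subset_image (Finset.mem_filter.1 (Finset.mem_product.1 (hwW i)).2).2)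
  have hinj : Set.InjOn (fun (w : Fin m → TPt (F.P K).d (Sect2.domCount (F.P K) Mc (k + 1)) × (recordDomSys F Mc k K).Dom) i => g3cLiftStep F Mc k K (w i))
      ↑(Fintype.piFinset (fun _ : Fin m => (X.1 : Finset (TPt (F.P K).d (Sect2.domCount (F.P K) Mc (k + 1)))) ×ˢ
        (Finset.univ : Finset (recordDomSys F Mc k K).Dom).filter (fun Y => (Y.1 : Finset (TPt (F.P K).d (Sect2.domCount (F.P K) Mc (k + 1)))) ⊆ X.1))) :=
    fun w _ w' _ h => funext fun i => g3cLiftStep_injective F Mc k K (congrFun h i)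
  rw [← Finset.sum_subset himg, Finset.sum_image hinj]
  · refine Finset.sum_congr rfl fun w _ => ?_
    show (if g3cWalkLocZ (fun i => ((q₀ i).valMinAbs : ℤ)) (fun i => g3cLiftStep F Mc k K (w i)) = intCubes F Mc k K X then
        g3cWalkTermZ F Mc TZY (intCubes F Mc k K X) x (pullPair F K φ) (fun i => ((q₀ i).valMinAbs : ℤ)) (fun i => g3cLiftStep F Mc k K (w i)) else 0) =
      if g3cWalkLoc F Mc k K q₀ w = X.1 then g3cWalkTerm F Mc k K TYK x φ q₀ w else 0
    by_cases hloc : g3cWalkLoc F Mc k K q₀ w = X.1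
    · obtain ⟨h0, hs⟩ := subset_of_g3cWalkLoc_eq hloc
      rw [if_pos hloc, if_pos ((g3cWalkLocZ_lift_iff hX q₀ w).2 hloc)]
      exact g3cWalkTermZ_lift hMc hK hX TYK TZY φ x hZsupp hZdom hZbr hsupp h0 hs
    · rw [if_neg hloc, if_neg (mt (g3cWalkLocZ_lift_iff hX q₀ w).1 hloc)]
  · -- an integer walk with a non-lifted step contributes nothing
    intro wh hwh hnot
    have hex : ∃ i, ∀ s ∈ (X.1 : Finset (TPt (F.P K).d (Sect2.domCount (F.P K) Mc (k + 1)))) ×ˢ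
        (Finset.univ : Finset (recordDomSys F Mc k K).Dom).filter (fun Y => (Y.1 : Finset (TPt (F.P K).d (Sect2.domCount (F.P K) Mc (k + 1)))) ⊆ X.1),
        g3cLiftStep F Mc k K s ≠ wh i := by
      by_contra hall
      have hall' : ∀ i, ∃ s ∈ (X.1 : Finset (TPt (F.P K).d (Sect2.domCount (F.P K) Mc (k + 1)))) ×ˢ
          (Finset.univ : Finset (recordDomSys F Mc k K).Dom).filter (fun Y => (Y.1 : Finset (TPt (F.P K).d (Sect2.domCount (F.P K) Mc (k + 1)))) ⊆ X.1),
          g3cLiftStep F Mc k K s = wh i := fun i => by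
        by_contra h'
        exact hall ⟨i, fun s hs hse => h' ⟨s, hs, hse⟩⟩
      choose sf hsf hsfe using hall'
      exact hnot (Finset.mem_image.2 ⟨sf, Fintype.mem_piFinset.2 hsf, funext hsfe⟩)
    obtain ⟨i, hi⟩ := hex
    obtain ⟨hwi1, hwi2⟩ := Finset.mem_product.1 (Fintype.mem_piFinset.1 hwh i)
    obtain ⟨q, hq, hqe⟩ := Finset.mem_image.1 hwi1
    have hnotlift : ∀ Y : (recordDomSys F Mc k K).Dom, (Y.1 : Finset (TPt (F.P K).d (Sect2.domCount (F.P K) Mc (k + 1)))) ⊆ X.1 →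
        intCubes F Mc k K Y ≠ (wh i).2 := fun Y hY hYe =>
      hi (q, Y) (Finset.mem_product.2 ⟨hq, Finset.mem_filter.2 ⟨Finset.mem_univ _, hY⟩⟩) (Prod.ext hqe hYe)
    have hT0 : twinMat F Mc TZY (intCubes F Mc k K X) (wh i).2 (pullPair F K φ) = 0 :=
      twinMat_eq_zero_of_not_lift X hZdom (Finset.mem_powerset.1 hwi2) hnotlift _ _
    have hstep : g3cStepMZ F Mc TZY (intCubes F Mc k K X) x (pullPair F K φ) (wh i) = 0 := by
      unfold g3cStepMZ
      split_ifs
      · rfl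
      · unfold g3cStepZ; rw [hT0, Matrix.zero_mul, Matrix.zero_mul, Matrix.zero_mul]
    have hprod : (List.ofFn fun j => g3cStepMZ F Mc TZY (intCubes F Mc k K X) x (pullPair F K φ) (wh j)).prod = 0 :=
      List.prod_eq_zero (List.mem_ofFn.2 ⟨i, hstep⟩)
    split_ifs
    · unfold g3cWalkTermZ; rw [hprod, Matrix.mul_zero, Matrix.trace_zero]
    · rfl

/-! ## §4  ★★★ The off-wrap bridge and row (gZ) -/

include hMc hK hX hZsupp hZdom hZbr hsupp in
/-- ★★★ **THE PIECE OF THE INTEGER TWIN IS THE TORUS WALK PIECE**: `(g3cWZ F Mc TZY x).piece X φ = g3cW … x φ X` for every `X ∉ recordWrapCtr`.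
[cite: Balaban1987RG1, (1.21) p.264; Balaban1985BackgroundPropagators, (3.90) p.409, (3.96) p.411] -/
theorem g3cWZ_piece_eq_g3cW : (g3cWZ F Mc TZY x).piece F Mc k K X φ = g3cW F Mc k K TYK x φ X := by
  show (∑' m : ℕ, (-1 : ℂ) ^ m * g3cWmZ F Mc TZY x m (intCubes F Mc k K X) (pullPair F K φ)) = ∑' m : ℕ, (-1 : ℂ) ^ m * g3cWm F Mc k K TYK x φ m X
  exact tsum_congr fun m => by rw [g3cWmZ_piece hMc hK hX TYK TZY φ x hZsupp hZdom hZbr hsupp m]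

include hMc hK hX hZsupp hZdom hZbr hsupp in
/-- ★★★ **… AND IS THE COLLECTED RESOLVENT PIECE `EG`**: the collector's seat `X_full` lies in the wrap class (✓`g3cFull_mem_recordWrapCtr`), so off it `g3cEG = g3cW`.
[cite: Balaban1985UV3, (23)–(25) p.262; Balaban1987RG1, (1.21) p.264] -/
theorem g3cWZ_piece_eq_g3cEG (TCK : Sect2.CPair (F.P K) (MatA 2) → FluctIdx F k K → FluctIdx F k K → ℂ) :
    (g3cWZ F Mc TZY x).piece F Mc k K X φ = g3cEG F Mc k K TCK TYK x X φ := by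
  classical
  have hne : X ≠ g3cFull F Mc k K := fun h => hX (h ▸ g3cFull_mem_recordWrapCtr F Mc k K)
  rw [g3cWZ_piece_eq_g3cW hMc hK hX TYK TZY φ x hZsupp hZdom hZbr hsupp]
  unfold g3cEG
  rw [G3CInv.collect_of_ne hne]

end Record

/-! ### Row (gZ) at the record -/

section Row

variable {F : T4Family}
variable {a₀ δ₀ c₀ γ₀ γ₁ : ℝ} {Mc : ℕ} {α₀ α₁ ε₂₉ : ℝ} {k : ℕ}
variable {TC : (n : ℕ) → Sect2.CPair (F.P (recordK₀ F Mc k + n)) (MatA 2) → FluctIdx F k (recordK₀ F Mc k + n) → FluctIdx F k (recordK₀ F Mc k + n) → ℂ}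
variable {TY : (n : ℕ) → (recordDomSys F Mc k (recordK₀ F Mc k + n)).Dom → Sect2.CPair (F.P (recordK₀ F Mc k + n)) (MatA 2) →
  FluctIdx F k (recordK₀ F Mc k + n) → FluctIdx F k (recordK₀ F Mc k + n) → ℂ}
variable {TZY : Finset (Fin 4 → ℤ) → IntBondCfg → ((Fin 4 → ℤ) × Fin 4) × Fin 3 → ((Fin 4 → ℤ) × Fin 4) × Fin 3 → ℂ}
variable {AdM : (n : ℕ) → (Site (F.P (recordK₀ F Mc k + n)) 0 → (MatA 2)ˣ) →
  Matrix (FluctIdx F k (recordK₀ F Mc k + n)) (FluctIdx F k (recordK₀ F Mc k + n)) ℂ}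
variable {AdZ : ((Fin 4 → ℤ) → (MatA 2)ˣ) → (Fin 4 → ℤ) × Fin 4 → Matrix (Fin 3) (Fin 3) ℂ}

/-- ★★★ **ROW (gZ) OF `G3CPiecesAt` FOR THE WALK PIECES**: with `EG x n X φ := g3cEG F Mc k (K₀+n) (TC n) (TY n) x X φ` and `EGZ x := g3cWZ F Mc TZY x`, the P0-ℂ carrier clauses
((Z-loc), (Z-cov), (Z-supp), (Z-dom), (Z-bridge), (P4-supp)) give, for EVERY `x` (no sign condition needed): `EGZ x` is window-local at side `L^{k+1}·Mc`, `SL(2,ℂ)`-invariant, and its pieces are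
`EG x n X φ` off the centred wrap class at every volume `K₀ + n` and every `φ`. [cite: Balaban1987RG1, (1.21) p.264, (1.7) p.261, (1.19) p.263; Balaban1985UV3, (23)–(25) p.262;
Balaban1985BackgroundPropagators, (3.90) p.409] -/
theorem g3cEGZ_row (hP : P0CarrierClauses F a₀ δ₀ c₀ γ₀ γ₁ Mc α₀ α₁ ε₂₉ k TC TY TZY AdM AdZ) (hMc : McGuard F Mc) (x : ℝ) :
    (g3cWZ F Mc TZY x).IsLocal (F.L ^ (k + 1) * Mc) ∧ (g3cWZ F Mc TZY x).IsGaugeInv ∧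
      ∀ (n : ℕ) (X : (recordDomSys F Mc k (recordK₀ F Mc k + n)).Dom), X ∉ recordWrapCtr F Mc k (recordK₀ F Mc k + n) →
        ∀ φ, (g3cWZ F Mc TZY x).piece F Mc k (recordK₀ F Mc k + n) X φ = g3cEG F Mc k (recordK₀ F Mc k + n) (TC n) (TY n) x X φ := by
  obtain ⟨hZsupp, hZdom, hZloc, hZcov, hZbr, -, -, -, hP4supp, -⟩ := hP
  refine ⟨isLocal_g3cWZ F Mc TZY k x hZloc, isGaugeInv_g3cWZ F Mc TZY AdZ x hZcov, fun n X hX φ => ?_⟩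
  exact g3cWZ_piece_eq_g3cEG hMc (Nat.le_add_right _ _) hX (TY n) TZY φ x hZsupp hZdom (fun Y hY ψ bi bj a a' hi hj => hZbr n Y hY ψ bi bj a a' hi hj)
    (fun Y ψ s s' h => fluct_supp_of_cube hMc (Nat.le_add_right _ _) (hP4supp n) Y ψ s s' h) (TC n)

end Row

end Summit.QuantumFields.YangMills.Theorems.BalabanUVNodesPortS1

end
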